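import Literature.Combinatorics.SimpleGraph.ColourRefinementCoarsest
import Summits.PneNP.PneNP.Theorems.SymmetryBudgetNoHiddenOrderBranchSumDefs

/-!
# Colour refinement INSIDE a block (per-path canoniser, `NoHiddenOrder`, (R2a) of PER-PATH.md §11)

Route `PneNP/SymmetryBudget`, `NoHiddenOrder` (stmt-PneNP-14781). The OR-steps of the Corneil–Goldberg process refine a
colouring of the current block `W ⊆ V` using the INDUCED subgraph only. This file transports the tree's ordered colour
refinement (`Literature/…/OrderedRefinementStable`, `…/ColourRefinementCoarsest`) from the induced subgraph `G.induce ↑W` to the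
`W`-relative vocabulary of `…BranchSumDefs` (`cellOf`, equitability as equality of neighbour counts in cells of `W`):

* `refineIn G W col : V → ℕ` — `|W|` rounds of ordered colour refinement of `col` on `G.induce ↑W`, read back on `V` (`0` off `W`);
* `refineIn_refines` — it refines `col` on `W`;
* `equitableIn_refineIn` — it is equitable inside `W` (hypothesis H2 / `ORSteps.star_equitable`);
* `refineIn_coarsest` — every colouring that is equitable inside `W` and refines `col` on `W` refines `refineIn G W col` on `W`
  (McKay–Piperno: the refinement is the coarsest equitable one);
* `indiv col x` — individualise `x` (`2·col + [· = x]`): `cellOf W (indiv col x) x = {x}` for `x ∈ W`, and it refines `col`;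
  hence `cellOf_refineIn_indiv` : after refining, `x` is still alone in its cell (`ORSteps.star_single`).

One definition of each kind; no choice beyond Mathlib's.
-/

-- `Summit.PneNP.PneNP.…` duplicates `PneNP` BY DESIGN (single-problem summit, D-0017 layout).
set_option linter.dupNamespace false

namespace Summit.PneNP.PneNP.Theorems

open Finset Literature.Combinatorics.SimpleGraph

namespace BranchSum

variable {V : Type*} [DecidableEq V] (G : SimpleGraph V) [DecidableRel G.Adj]

/-- Ordered colour refinement of `col` run for `|W|` rounds on the induced subgraph `G.induce ↑W`, read back on `V`
(vertices outside `W` get `0`). -/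
noncomputable def refineIn (W : Finset V) (col : V → ℕ) : V → ℕ := fun v =>
  if h : v ∈ W then ocrIter (G.induce (W : Set V)) (fun x : ↥(W : Set V) => col x) W.card ⟨v, mem_coe.2 h⟩ else 0

/-- Individualise `x`: double every colour and mark `x`. -/
def indiv (col : V → ℕ) (x : V) : V → ℕ := fun v => 2 * col v + if v = x then 1 else 0

variable {G}

/-- On `W`, `refineIn` is the induced-subgraph refinement. -/
theorem refineIn_apply {W : Finset V} (col : V → ℕ) {v : V} (hv : v ∈ W) :
    refineIn G W col v = ocrIter (G.induce (W : Set V)) (fun x : ↥(W : Set V) => col x) W.card ⟨v, mem_coe.2 hv⟩ := by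
  unfold refineIn; rw [dif_pos hv]

/-- `refineIn` refines `col` on `W`. -/
theorem refineIn_refines {W : Finset V} (col : V → ℕ) {u v : V} (hu : u ∈ W) (hv : v ∈ W)
    (h : refineIn G W col u = refineIn G W col v) : col u = col v := by
  rw [refineIn_apply col hu, refineIn_apply col hv] at h
  exact eq_of_ocrIter_eq (G := G.induce (W : Set V)) h

omit [DecidableEq V] in
/-- Neighbour counts in a cell of `W`, read on the induced subgraph. -/
theorem card_filter_cellOf_eq_natCard {W : Finset V} (c : V → ℕ) (u : ↥(W : Set V)) (w : V) :
    ((cellOf W c w).filter fun y => G.Adj u y).card =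
      Nat.card {y : ↥(W : Set V) // (G.induce (W : Set V)).Adj u y ∧ c y = c w} := by
  rw [Nat.card_eq_fintype_card, Fintype.card_subtype]
  -- compare the two finsets along `Subtype.val`
  rw [← card_map (Function.Embedding.subtype fun y => y ∈ (W : Set V))]
  congr 1
  ext y
  simp only [mem_filter, mem_cellOf_iff, mem_map, mem_univ, true_and, Function.Embedding.coe_subtype,
    SimpleGraph.induce_adj, Subtype.exists, mem_coe, exists_and_left, exists_prop, exists_eq_right_right]
  tauto

/-- **`refineIn` is equitable inside `W`** (`ORSteps.star_equitable`, hypothesis H2). -/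
theorem equitableIn_refineIn (W : Finset V) (col : V → ℕ) {u : V} (hu : u ∈ W) {v : V} (hv : v ∈ W)
    (huv : refineIn G W col u = refineIn G W col v) {w : V} (hw : w ∈ W) :
    ((cellOf W (refineIn G W col) w).filter fun y => G.Adj u y).card =
      ((cellOf W (refineIn G W col) w).filter fun y => G.Adj v y).card := by
  have hcardW : Fintype.card (↥(W : Set V)) = W.card := by simp
  have heq := isEquitable_ocrIter (G := G.induce (W : Set V)) (fun x : ↥(W : Set V) => col x) (t := W.card) (by omega)
  have h1 := card_filter_cellOf_eq_natCard (G := G) (refineIn G W col) ⟨u, mem_coe.2 hu⟩ w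
  have h2 := card_filter_cellOf_eq_natCard (G := G) (refineIn G W col) ⟨v, mem_coe.2 hv⟩ w
  rw [h1, h2]
  -- rewrite the colour condition `refineIn … y = refineIn … w` on the subtype through `ocrIter`
  set ρ := ocrIter (G.induce (W : Set V)) (fun x : ↥(W : Set V) => col x) W.card with hρ
  have hre : ∀ a : ↥(W : Set V), {y : ↥(W : Set V) // (G.induce (W : Set V)).Adj a y ∧ refineIn G W col y = refineIn G W col w} =
      {y : ↥(W : Set V) // (G.induce (W : Set V)).Adj a y ∧ ρ y = ρ ⟨w, mem_coe.2 hw⟩} := by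
    intro a
    congr 1; ext y
    rw [refineIn_apply col (mem_coe.1 y.2), refineIn_apply col hw]
  rw [hre, hre]
  rw [refineIn_apply col hu, refineIn_apply col hv] at huv
  exact heq _ _ huv _

/-- **`refineIn` is the coarsest equitable refinement inside `W`**: a colouring that is equitable inside `W` and refines
`col` on `W` refines `refineIn G W col` on `W`. -/
theorem refineIn_coarsest {W : Finset V} {col c' : V → ℕ}
    (heq : ∀ u ∈ W, ∀ v ∈ W, c' u = c' v → ∀ w ∈ W,
      ((cellOf W c' w).filter fun y => G.Adj u y).card = ((cellOf W c' w).filter fun y => G.Adj v y).card)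
    (hfin : ∀ u ∈ W, ∀ v ∈ W, c' u = c' v → col u = col v) {u v : V} (hu : u ∈ W) (hv : v ∈ W) (huv : c' u = c' v) :
    refineIn G W col u = refineIn G W col v := by
  -- `c'` read on the subtype is equitable for the induced subgraph
  have hc' : IsEquitable (G.induce (W : Set V)) (fun x : ↥(W : Set V) => c' x) := by
    intro a b hab y
    by_cases hy : ∃ w : ↥(W : Set V), c' w = y
    · obtain ⟨w, rfl⟩ := hy
      rw [← card_filter_cellOf_eq_natCard, ← card_filter_cellOf_eq_natCard]
      exact heq a (mem_coe.1 a.2) b (mem_coe.1 b.2) hab w (mem_coe.1 w.2)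
    · push Not at hy
      haveI : IsEmpty {z : ↥(W : Set V) // (G.induce (W : Set V)).Adj a z ∧ c' z = y} := ⟨fun z => hy z.1 z.2.2⟩
      haveI : IsEmpty {z : ↥(W : Set V) // (G.induce (W : Set V)).Adj b z ∧ c' z = y} := ⟨fun z => hy z.1 z.2.2⟩
      rw [Nat.card_of_isEmpty, Nat.card_of_isEmpty]
  rw [refineIn_apply col hu, refineIn_apply col hv]
  exact hc'.ocrIter_eq_of_finer (G := G.induce (W : Set V)) (fun a b hab => hfin a (mem_coe.1 a.2) b (mem_coe.1 b.2) hab)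
    W.card (u := ⟨u, mem_coe.2 hu⟩) (v := ⟨v, mem_coe.2 hv⟩) huv

/-- `indiv` refines `col`. -/
theorem indiv_refines (col : V → ℕ) (x : V) {u v : V} (h : indiv col x u = indiv col x v) : col u = col v := by
  unfold indiv at h
  split_ifs at h <;> omega

/-- `x` is alone in its `indiv` cell. -/
theorem cellOf_indiv {W : Finset V} (col : V → ℕ) {x : V} (hx : x ∈ W) : cellOf W (indiv col x) x = {x} := by
  ext v
  rw [mem_cellOf_iff, mem_singleton]
  constructor
  · rintro ⟨-, h⟩
    unfold indiv at h
    by_contra hv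
    rw [if_neg hv, if_pos rfl] at h
    omega
  · rintro rfl; exact ⟨hx, rfl⟩

/-- **After refining an individualised colouring, `x` is still alone in its cell** (`ORSteps.star_single`). -/
theorem cellOf_refineIn_indiv {W : Finset V} (col : V → ℕ) {x : V} (hx : x ∈ W) :
    cellOf W (refineIn G W (indiv col x)) x = {x} := by
  ext v
  rw [mem_cellOf_iff, mem_singleton]
  constructor
  · rintro ⟨hv, h⟩
    have := refineIn_refines (G := G) (indiv col x) hv hx h
    have hmem : v ∈ cellOf W (indiv col x) x := mem_cellOf_iff.2 ⟨hv, this⟩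
    rw [cellOf_indiv col hx, mem_singleton] at hmem
    exact hmem
  · rintro rfl; exact ⟨hx, rfl⟩

end BranchSum

end Summit.PneNP.PneNP.Theorems
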